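import Summits.QuantumFields.YangMills.Theorems.UnitScaleTiltProp7SkewFrobRowAssembly
import Summits.QuantumFields.YangMills.Theorems.UnitScaleTiltProp7TraceSplitFrobeniusRow
import Summits.QuantumFields.YangMills.Theorems.UnitScaleTiltProp7TubeComparisonScalarRow
import HarnessLib

/-!
# Route `UnitScaleTilt`, crux «MinimiserStabilityRegPr» (stmt-QuantumFields-19200), stub `stub_existenceMinimalOrbit` (EX), pen (b1) —
# **THE FINAL KNIT OF THE TUBE-COMPARISON ROW: `hQcmp` (free-`CT` form, `CT = 4`) FOR EVERY CARRIER AT A PRINTED-REGULAR BACKGROUND,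
# MODULO THE THREE 𝔰𝔲(2) ROWS (R1) = (iv), (R2) = DEFECT-via-bridge, (R3) = LEG-sequel**

Cell `ym3-torus`, twin-width seat `ym-ust-19200-w7` (gen 10).  THEOREMS ONLY (0 `def`, 0 `sorry`); `--supports stmt-QuantumFields-19200 --as helper`, count-neutral.
YM₃ on T³ is ladder rung R3 — NOT d = 4, NOT infinite volume, NOT a mass gap, NOT Clay; nothing here claims a print row, the stub or the crux.

THE KNIT (★★OWNER WORD 52 book, holder w7): for `RegPr F n K ε₀ W`, `10¹²L³ε₀ ≤ 1`, abstract operators `S G : (fine fields) → (coarse fields)` and a unitary frame `Φ` with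
(R1)(R2)(R3) on 𝔰𝔲(2)-VALUED carriers (anti-Hermitian AND traceless — the class of ✓`Prop7QSymEqTrueLinIter…` and px13's sequel), the displayed row of
✓`Prop7TransverseRowOfQTwSTubeComparison.sum_normSq_le_curl_sq_add_divB_sq_add_QTwS_of_tubeRowC` holds for EVERY `M₂(ℂ)` carrier with `CT = 4` and
`Cq := (8(ℓ^d)²E₂ + 8E₁)∕(ε₀²ℓ^dℓ²)`.  Chain, all BY NAME: 𝔰𝔲(2) row = ✓`Prop7SkewFrobRowAssembly.skewFrobRow_of_rows_of_le`; scalar row = ✓`Prop7TubeComparisonScalarRow.scalarRow_of_regPr`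
(an identity); 𝔲(2) row = ✓`Prop7TraceSplitFrobeniusRow.skewRow_of_traceless_row_of_scalar_row` (side conditions: the corner tube preserves «traceless» (trace cyclicity) and «scalar»
(✓`tubeStr_smul_one`); `QTwS W` does by ✓`trace_QTwS_eq_zero_of_regPr` ∕ ✓`QTwS_scalar_of_regPr`); all carriers + op norms = ✓`Prop7TubeComparisonRowOfSkewRow.tubeRowC_of_skewFrobRow`.
[Balaban1984PropagatorsI] (1.18) p.20; [Balaban1985BackgroundPropagators] (3.13)–(3.15) p.393; [Balaban1985Variational] (51) p.286; [Balaban1985Averaging] (18)–(20) p.21.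
-/

set_option autoImplicit false

noncomputable section

open scoped BigOperators Matrix.Norms.L2Operator Matrix InnerProductSpace

namespace Summit.QuantumFields.YangMills.Theorems.Prop7TubeComparisonKnit

open Literature.MathematicalPhysics.QuantumFieldTheory.Balaban1983to89
open Finset B1RG242Torus
open B7Prop1Explicit (treeWord)
open B7Prop2Explicit (unitaryUnits)
open B7Eq78Linearization (conjR conjR_apply)
open B10Eq27TorusAxialLog (holT unitsField toUField)
open T3ContinuumYM3Torus (T3Family)
open T3LevelShift (bondShift)
open T3PrintedRegularOrbits (sites_eq)
open T3PrintedRegularMinimiser (RegPr)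
open Summit.QuantumFields.YangMills.Theorems.Prop7SectET3HilbertLetters (W₂ frobEquiv)
open Summit.QuantumFields.YangMills.Theorems.Prop7SymAvgTwSym (QTwS QTwS_scalar_of_regPr)
open Summit.QuantumFields.YangMills.Theorems.Prop7QTwSRealitySectors (trace_QTwS_eq_zero_of_regPr)
open Summit.QuantumFields.YangMills.Theorems.Prop7SkewFrobRowAssembly (skewFrobRow_of_rows_of_le)
open Summit.QuantumFields.YangMills.Theorems.Prop7TraceSplitFrobeniusRow (skewRow_of_traceless_row_of_scalar_row)
open Summit.QuantumFields.YangMills.Theorems.Prop7TubeComparisonScalarRow (tubeStr_smul_one scalarRow_of_regPr)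
open Summit.QuantumFields.YangMills.Theorems.Prop7TubeComparisonRowOfSkewRow (tubeRowC_of_skewFrobRow)

variable (F : T3Family) (n K : ℕ)

/-! ## §1 The corner tube preserves «traceless» -/

/-- `tr(R(u)M) = tr M` for a unit `u`. [cite: Balaban1985Averaging, (56) p.27] -/
theorem trace_conjR (u : (Matrix (Fin 2) (Fin 2) ℂ)ˣ) (M : Matrix (Fin 2) (Fin 2) ℂ) : (conjR u M).trace = M.trace := by
  rw [conjR_apply, Matrix.trace_mul_cycle, Units.inv_mul, Matrix.one_mul]

/-- ★ **THE CORNER TUBE OF A TRACELESS FIELD IS TRACELESS** (every background). [cite: Balaban1984PropagatorsI, (1.18) p.20] -/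
theorem trace_tubeStr_eq_zero (W : GaugeField (F.P K) 0 (Matrix.specialUnitaryGroup (Fin 2) ℂ)) (X : PBond (F.P K) 0 → Matrix (Fin 2) (Fin 2) ℂ)
    (hX : ∀ b, (X b).trace = 0) (c : PBond (F.P K) (K - n)) :
    (∑ r : Fin (F.P K).d → Fin ((F.P K).L ^ (K - n)), ∑ t ∈ range ((F.P K).L ^ (K - n)),
        conjR (holT (unitsField (toUField W)) (Site.fibreSite 0 (K - n) c.src fun _ => ⟨0, pow_pos (F.P K).L_pos (K - n)⟩)
              (treeWord fun ν => ((r ν : ℕ) : ℤ))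
            * holT (unitsField (toUField W)) (Site.fibreSite 0 (K - n) c.src r) (List.replicate t (c.dir, true)))
          (X ⟨(fun z : Site (F.P K) 0 => z.shift c.dir)^[t] (Site.fibreSite 0 (K - n) c.src r), c.dir⟩)).trace = 0 := by
  rw [Matrix.trace_sum]
  refine Finset.sum_eq_zero fun r _ => ?_
  rw [Matrix.trace_sum]
  exact Finset.sum_eq_zero fun t _ => by rw [trace_conjR, hX]

variable (h : n ≤ K)

/-! ## §2 The knit -/

/-- ★★★ **THE FINAL KNIT OF PEN (b1)**: at `RegPr F n K ε₀ W` (`10¹²L³ε₀ ≤ 1`), rows (R1) = (iv), (R2) = DEFECT via the stair bridge, (R3) = LEG-sequel on 𝔰𝔲(2)-valued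
carriers (abstract `S G`, unitary frame `Φ`, uniform `0 ≤ E₁, E₂`) give the tube-comparison row for EVERY carrier `X` with `CT = 4`:
`Σ_c‖T^{str}_W X(c)‖² ≤ 4(ℓ^d)²·Σ_{c'}‖QTwS W X c'‖² + ((8(ℓ^d)²E₂ + 8E₁)∕(ε₀²ℓ^dℓ²))·ε₀²·ℓ^dℓ²·Σ_b‖X b‖²` — the `hQcmp` binder of ✓`…_of_tubeRowC` ∕ ✓`hT_of_tubeRowC`.
[cite: Balaban1984PropagatorsI, (1.18) p.20; Balaban1985BackgroundPropagators, (3.13)-(3.15) p.393; Balaban1985Variational, (51) p.286] -/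
theorem tubeRowC_of_su2Rows {ε₀ : ℝ} (hε₀ : 0 < ε₀) (hWε : 10 ^ 12 * (F.L : ℝ) ^ 3 * ε₀ ≤ 1)
    (W : GaugeField (F.P K) 0 (Matrix.specialUnitaryGroup (Fin 2) ℂ)) (hreg : RegPr F n K ε₀ W)
    (S G : (PBond (F.P K) 0 → Matrix (Fin 2) (Fin 2) ℂ) → PBond (F.P K) (K - n) → Matrix (Fin 2) (Fin 2) ℂ)
    (Φ : PBond (F.P K) (K - n) → (Matrix (Fin 2) (Fin 2) ℂ)ˣ) (hΦ : ∀ c, Φ c ∈ unitaryUnits (Matrix (Fin 2) (Fin 2) ℂ))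
    {E₁ E₂ : ℝ} (hE₁ : 0 ≤ E₁) (hE₂ : 0 ≤ E₂)
    -- (R1) = (iv): corner tree words vs framed stair means, on 𝔰𝔲(2)-valued carriers [routeR-w4 g25]
    (hR1 : ∀ A : PBond (F.P K) 0 → Matrix (Fin 2) (Fin 2) ℂ, (∀ b, (A b)ᴴ = -A b) → (∀ b, (A b).trace = 0) →
      ∑ c : PBond (F.P K) (K - n), ‖(frobEquiv.symm ((∑ r : Fin (F.P K).d → Fin ((F.P K).L ^ (K - n)), ∑ t ∈ range ((F.P K).L ^ (K - n)),
        conjR (holT (unitsField (toUField W)) (Site.fibreSite 0 (K - n) c.src fun _ => ⟨0, pow_pos (F.P K).L_pos (K - n)⟩)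
              (treeWord fun ν => ((r ν : ℕ) : ℤ))
            * holT (unitsField (toUField W)) (Site.fibreSite 0 (K - n) c.src r) (List.replicate t (c.dir, true)))
          (A ⟨(fun z : Site (F.P K) 0 => z.shift c.dir)^[t] (Site.fibreSite 0 (K - n) c.src r), c.dir⟩))
        - ((((F.L : ℝ) ^ (K - n)) ^ (F.P K).d : ℝ) : ℂ) • conjR (Φ c) (S A c)) : W₂)‖ ^ 2
      ≤ E₁ * ∑ b : PBond (F.P K) 0, ‖(frobEquiv.symm (A b) : W₂)‖ ^ 2)
    -- (R2) = DEFECT via the stair bridge [✓`Prop7TrueLinIterDefect` + ✓`Prop7TrueLinIterDefectOfStairGauge`]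
    (hR2 : ∀ A : PBond (F.P K) 0 → Matrix (Fin 2) (Fin 2) ℂ, (∀ b, (A b)ᴴ = -A b) → (∀ b, (A b).trace = 0) →
      ∑ c : PBond (F.P K) (K - n), ‖(frobEquiv.symm (S A c - G A c) : W₂)‖ ^ 2 ≤ E₂ * ∑ b : PBond (F.P K) 0, ‖(frobEquiv.symm (A b) : W₂)‖ ^ 2)
    -- (R3) = LEG ⊕ STRUCTURE ⊕ coarse-gauge identity [px13 g11's sequel]
    (hR3 : ∀ A : PBond (F.P K) 0 → Matrix (Fin 2) (Fin 2) ℂ, (∀ b, (A b)ᴴ = -A b) → (∀ b, (A b).trace = 0) →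
      ∀ c' : PBond (F.P n) 0, QTwS F n K h W A c' = G A (bondShift (sites_eq F n K h) c'))
    (X : PBond (F.P K) 0 → Matrix (Fin 2) (Fin 2) ℂ) :
    ∑ c : PBond (F.P K) (K - n), ‖∑ r : Fin (F.P K).d → Fin ((F.P K).L ^ (K - n)), ∑ t ∈ range ((F.P K).L ^ (K - n)),
        conjR (holT (unitsField (toUField W)) (Site.fibreSite 0 (K - n) c.src fun _ => ⟨0, pow_pos (F.P K).L_pos (K - n)⟩)
              (treeWord fun ν => ((r ν : ℕ) : ℤ))
            * holT (unitsField (toUField W)) (Site.fibreSite 0 (K - n) c.src r) (List.replicate t (c.dir, true)))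
          (X ⟨(fun z : Site (F.P K) 0 => z.shift c.dir)^[t] (Site.fibreSite 0 (K - n) c.src r), c.dir⟩)‖ ^ 2
      ≤ 4 * (((F.L : ℝ) ^ (K - n)) ^ (F.P K).d) ^ 2 * ∑ c' : PBond (F.P n) 0, ‖QTwS F n K h W X c'‖ ^ 2
        + ((8 * (((F.L : ℝ) ^ (K - n)) ^ (F.P K).d) ^ 2 * E₂ + 8 * E₁) / (ε₀ ^ 2 * ((((F.L : ℝ) ^ (K - n)) ^ (F.P K).d) * ((F.L : ℝ) ^ (K - n)) ^ 2)))
          * ε₀ ^ 2 * ((((F.L : ℝ) ^ (K - n)) ^ (F.P K).d) * ((F.L : ℝ) ^ (K - n)) ^ 2) * ∑ b : PBond (F.P K) 0, ‖X b‖ ^ 2 := by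
  classical
  -- windows and the positivity instances the reality theorems want
  have hL3 : (3 : ℝ) ≤ (F.L : ℝ) := by
    have h3 : 3 ≤ F.L := by obtain ⟨a, ha⟩ := F.hL.1; have := F.hL.2; omega
    exact_mod_cast h3
  have hLpos : (0 : ℝ) < (F.L : ℝ) := by linarith
  haveI : Fact (0 < (F.L : ℝ)) := ⟨hLpos⟩
  haveI : Fact (0 < ((F.L : ℝ)⁻¹) ^ (K - n)) := ⟨pow_pos (inv_pos.mpr hLpos) _⟩
  have hWe : 10 ^ 9 * (F.L : ℝ) ^ 2 * ε₀ ≤ 1 := by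
    have h1 : (F.L : ℝ) ^ 2 ≤ (F.L : ℝ) ^ 3 := pow_le_pow_right₀ (by linarith) (by norm_num)
    nlinarith [h1, hε₀.le, pow_nonneg hLpos.le 2]
  have hℓpos : (0 : ℝ) < (F.L : ℝ) ^ (K - n) := pow_pos hLpos _
  set ld : ℝ := ((F.L : ℝ) ^ (K - n)) ^ (F.P K).d with hld
  set l2 : ℝ := ((F.L : ℝ) ^ (K - n)) ^ 2 with hl2
  have hldpos : 0 < ld := by rw [hld]; positivity
  have hl2pos : 0 < l2 := by rw [hl2]; positivity
  -- the two maps as ℂ-linear maps of matrix fields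
  let T : (PBond (F.P K) 0 → Matrix (Fin 2) (Fin 2) ℂ) →ₗ[ℂ] (PBond (F.P K) (K - n) → Matrix (Fin 2) (Fin 2) ℂ) :=
    { toFun := fun X c => ∑ r : Fin (F.P K).d → Fin ((F.P K).L ^ (K - n)), ∑ t ∈ range ((F.P K).L ^ (K - n)),
        conjR (holT (unitsField (toUField W)) (Site.fibreSite 0 (K - n) c.src fun _ => ⟨0, pow_pos (F.P K).L_pos (K - n)⟩)
              (treeWord fun ν => ((r ν : ℕ) : ℤ))
            * holT (unitsField (toUField W)) (Site.fibreSite 0 (K - n) c.src r) (List.replicate t (c.dir, true)))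
          (X ⟨(fun z : Site (F.P K) 0 => z.shift c.dir)^[t] (Site.fibreSite 0 (K - n) c.src r), c.dir⟩)
      map_add' := fun X Y => by
        funext c
        simp only [Pi.add_apply, conjR_apply, mul_add, add_mul, Finset.sum_add_distrib]
      map_smul' := fun a X => by
        funext c
        simp only [Pi.smul_apply, conjR_apply, Matrix.mul_smul, Matrix.smul_mul, Finset.smul_sum, RingHom.id_apply] }
  let Q : (PBond (F.P K) 0 → Matrix (Fin 2) (Fin 2) ℂ) →ₗ[ℂ] (PBond (F.P n) 0 → Matrix (Fin 2) (Fin 2) ℂ) := (QTwS F n K h W : _ →L[ℂ] _)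
  -- side conditions of the trace split
  have hT0 : ∀ X : PBond (F.P K) 0 → Matrix (Fin 2) (Fin 2) ℂ, (∀ b, (X b).trace = 0) → ∀ c, (T X c).trace = 0 :=
    fun X hX c => trace_tubeStr_eq_zero F n K W X hX c
  have hT1 : ∀ s : PBond (F.P K) 0 → ℂ, ∀ c, ∃ μ : ℂ, T (fun b => s b • (1 : Matrix (Fin 2) (Fin 2) ℂ)) c = μ • (1 : Matrix (Fin 2) (Fin 2) ℂ) :=
    fun s c => ⟨_, tubeStr_smul_one F n K W s c⟩
  have hQ0 : ∀ X : PBond (F.P K) 0 → Matrix (Fin 2) (Fin 2) ℂ, (∀ b, (X b).trace = 0) → ∀ d, (Q X d).trace = 0 :=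
    fun X hX d => trace_QTwS_eq_zero_of_regPr F h hε₀ hε₀ hWe hWε W hreg X hX d
  have hQ1 : ∀ s : PBond (F.P K) 0 → ℂ, ∀ d, ∃ μ : ℂ, Q (fun b => s b • (1 : Matrix (Fin 2) (Fin 2) ℂ)) d = μ • (1 : Matrix (Fin 2) (Fin 2) ℂ) := by
    intro s d
    obtain ⟨e, he⟩ := QTwS_scalar_of_regPr F h hε₀ hWε W hreg s
    exact ⟨e d, by change QTwS F n K h W (fun b => s b • (1 : Matrix (Fin 2) (Fin 2) ℂ)) d = _; rw [he]⟩
  -- the 𝔰𝔲(2) row (assembly door) and the scalar row (identity), with the common slack β := 4 ld² E₂ + 4 E₁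
  have hβ : 0 ≤ 4 * ld ^ 2 * E₂ + 4 * E₁ := by positivity
  have hrow0 : ∀ A₀ : PBond (F.P K) 0 → Matrix (Fin 2) (Fin 2) ℂ, (∀ b, (A₀ b)ᴴ = -A₀ b) → (∀ b, (A₀ b).trace = 0) →
      ∑ c, ‖(frobEquiv.symm (T A₀ c) : W₂)‖ ^ 2
        ≤ (2⁻¹ * 4 * ld ^ 2) * ∑ d, ‖(frobEquiv.symm (Q A₀ d) : W₂)‖ ^ 2 + (4 * ld ^ 2 * E₂ + 4 * E₁) * ∑ b, ‖(frobEquiv.symm (A₀ b) : W₂)‖ ^ 2 :=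
    fun A₀ hsk htr => skewFrobRow_of_rows_of_le F n K h W A₀ (S A₀) (G A₀) Φ hΦ le_rfl (hR1 A₀ hsk htr) (hR2 A₀ hsk htr) (hR3 A₀ hsk htr)
  have hrow1 : ∀ s : PBond (F.P K) 0 → ℂ, (∀ b, star (s b) = -s b) →
      ∑ c, ‖(frobEquiv.symm (T (fun b => s b • (1 : Matrix (Fin 2) (Fin 2) ℂ)) c) : W₂)‖ ^ 2
        ≤ (2⁻¹ * 4 * ld ^ 2) * ∑ d, ‖(frobEquiv.symm (Q (fun b => s b • (1 : Matrix (Fin 2) (Fin 2) ℂ)) d) : W₂)‖ ^ 2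
          + (4 * ld ^ 2 * E₂ + 4 * E₁) * ∑ b, ‖(frobEquiv.symm (s b • (1 : Matrix (Fin 2) (Fin 2) ℂ)) : W₂)‖ ^ 2 :=
    fun s _ => scalarRow_of_regPr F n K h hε₀ hWε W hreg (by norm_num : (2 : ℝ) ≤ 4) hβ s
  -- the 𝔲(2) row
  have hrowU : ∀ A : PBond (F.P K) 0 → Matrix (Fin 2) (Fin 2) ℂ, (∀ b, (A b)ᴴ = -A b) →
      ∑ c, ‖(frobEquiv.symm (T A c) : W₂)‖ ^ 2
        ≤ (2⁻¹ * 4 * ld ^ 2) * ∑ d, ‖(frobEquiv.symm (Q A d) : W₂)‖ ^ 2 + (4 * ld ^ 2 * E₂ + 4 * E₁) * ∑ b, ‖(frobEquiv.symm (A b) : W₂)‖ ^ 2 :=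
    fun A hA => skewRow_of_traceless_row_of_scalar_row T Q hT0 hT1 hQ0 hQ1 _ _ hrow0 hrow1 A hA
  -- all carriers, op norms, CT = 4, Cq := (8 ld² E₂ + 8 E₁)/(ε₀² ld l2)
  have hCq : 0 ≤ (8 * ld ^ 2 * E₂ + 8 * E₁) / (ε₀ ^ 2 * (ld * l2)) := by positivity
  have hslack : 2⁻¹ * ((8 * ld ^ 2 * E₂ + 8 * E₁) / (ε₀ ^ 2 * (ld * l2))) * ε₀ ^ 2 * (ld * l2) = 4 * ld ^ 2 * E₂ + 4 * E₁ := by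
    field_simp
    ring
  have hrow' : ∀ A : PBond (F.P K) 0 → Matrix (Fin 2) (Fin 2) ℂ, (∀ b, (A b)ᴴ = -A b) →
      ∑ c, ‖(frobEquiv.symm (T A c) : W₂)‖ ^ 2
        ≤ (2⁻¹ * 4 * ld ^ 2) * ∑ d, ‖(frobEquiv.symm (Q A d) : W₂)‖ ^ 2
          + (2⁻¹ * ((8 * ld ^ 2 * E₂ + 8 * E₁) / (ε₀ ^ 2 * (ld * l2))) * ε₀ ^ 2 * (ld * l2)) * ∑ b, ‖(frobEquiv.symm (A b) : W₂)‖ ^ 2 := by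
    intro A hA; rw [hslack]; exact hrowU A hA
  exact tubeRowC_of_skewFrobRow F n K h hε₀ hWε W hreg (by norm_num : (0 : ℝ) ≤ 4) hCq hrow' X

end Summit.QuantumFields.YangMills.Theorems.Prop7TubeComparisonKnit

end
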